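import Summits.BirchSwinnertonDyer.BirchSwinnertonDyer.Theorems.KatoDescentTamePotSupersingularTameLowerFouquetRoadBCS
import Summits.BirchSwinnertonDyer.BirchSwinnertonDyer.Theorems.KatoDescentTamePotSupersingularTameLowerSeedRecordTools
import HarnessLib

/-!
# Route `KatoDescentTamePotSupersingular` (rung K8-t′, cell `bsd-potss`): open core `TameLowerIntrinsicNonCM`
# (item stmt-BirchSwinnertonDyer-19618) — PER-ROW RECORDS 01 of the THIRD seed road `SeedRowC`
# (Fouquet 2025 Thm 4.1 (1)⇒(2) + Burungale–Castella–Skinner 2025 Thm 1.1.2 (b); NO `Ram`, rank or `L`-value condition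
# on the partner) on the CONTENT rows of the cell `L_{II*,5}` (a `--supports … --as helper` file; seat `bsd-potss-k8t-c2`, gen 9)

Rows in this file: `40200g1` ← `1608a1`, `50575q1` ← `2023b1`, `63700d1` ← `2548a1`.

For each row `W` (Cremona's minimal model, `N_W = 25·N_G`, additive potentially supersingular TAME (t′) at `5`, Kodaira
`II*`, `v₅(c₄) = 4`; `r_an = 0`, `5 ∣ #Ш_an` — a CONTENT row of the 19618 census) and its congruent partner `G` at
`N_G = N_W/25` (plan g16 `UNITSEED-content-congruentG.tsv`: rank `2`, good ORDINARY at `5`, `ρ̄_{G,5}` onto), the record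
`tameLower_bcs_v<label>` is the SeedRowC road `Theorems.missingLowerBoundAt_rankZero_of_bcsSeed_of_prop4` (p484443)
instantiated: `MissingLowerBoundAt W 5` (L₀ = `ord₅ #Ш_an ≤ ord₅ #Ш`) from
* IN THE KERNEL (`decide` on Cremona's coefficients, tools `Theorems.KTSeedRec.*`): `Δ ≠ 0` and global minimality of
  `W` and `G` (Kraus, factored form; stated as the four theorems `isElliptic_…` / `isGloballyMinimal_…` and taken by the
  record as instance binders); `ρ̄_{W,5}`, `ρ̄_{G,5}` onto (three Serre Prop. 19 witnesses each,
  `Supersingular.surj_of_ainvs_of_serreWitnesses`); `GoodOrd G 5` (`5 ∤ Δ_G`, point count); `FouquetLevelCompatibleAt 5 W G`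
  and `Fouquet2025.Assumption34TateAt 5 W` from the kernel factorisation of `Δ`; Fouquet's Ass. 2.9 (2) EXACTLY
  (`FouquetGenericAt 5 W`: `ΨSq_5` has no root in `ℚ_5`) by two Hensel root censuses of x10b's `RootCensusNewton.check₄`;
* NAMED PUBLISHED INPUTS in hypothesis position: (A′) `Fouquet2025.padicValRat_bsd_rank_zero_of_congruence_of_seedMainIdentity`
  (`hA`), `burungale_castella_skinner_charIdeal_eq_padicLFunction_integral` (`hBCS`), modularity `exists_isNewformOf`
  (`hmodN`), GZK (`hGZK`), Kraus–Oesterlé 1992 Prop. 4 `KrausOesterle1992.prop4_torsionIso_of_congruences` (`hKO`);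
* EVIDENCE binders per row: `r_an(W) = 0` (`hr`, Cremona) and the FINITE Kraus–Oesterlé trace list `hlist` (all primes
  `ℓ < μ(M)/6`: `a_ℓ(W) ≡ a_ℓ(G) (mod 5)` off `N_W N_G`, `a_ℓ a'_ℓ ≡ ℓ + 1` at `ℓ ∥ N_W N_G`) — kit j265271/j265273/j265274/j265275 (tag bsd),
  engines VERBATIM from kt-pdesc g2 (j261046; reused by this seat's g8 j262735): A = `scan.gp` (PARI/GP, sha16
  d3ab08156e6bffa3: mod-5 screen of EVERY Cremona curve at `N_G`, K–O Prop. 4 verbatim on each survivor), B = `engineB.py`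
  (sha16 8f806e99f286370b, PARI-free point counts) re-deriving the verdict; per-pair modulus / bound / prime count in each
  docstring and in `HOME/k8t-c2/g9/SEEDROWC-CENSUS.tsv`.
TIER per row (docstring): `a₅(G)² ≢ 1 (mod 5)` = preprint-free chain (Fouquet Thm 2.10 via Nakamura 2023); `≡ 1` = flag
`@Fouquet-2.10-via-ColmezWang-PRE` (the census' tier B). HONEST LABEL: per-row instances of `SeedRowC`, CONDITIONAL on the
named published inputs; the class-wide statement (Kato's Conj. 12.10 lower inclusion at an additive potentially
supersingular prime) and the items 19618 / 19981 stay OPEN; nothing is booked; BSD is not proved for any curve here.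

References: [Fouquet2025EquivariantTNC] Thm 4.1, Thm 1.7 (2), Ass. 2.9, Ass. 3.4; [BurungaleCastellaSkinner2025] Thm 1.1.2 (b);
[KrausOesterle1992] Prop. 4; [Serre1972] §2.8 Prop. 19; [Kraus1989]; [SilvermanAEC2009] VII.1, VII.5 Prop. 5.1, Ex. 3.7;
[Cremona1997] Table 1; [Miller2011LMS] Def. 1.1.
-/

set_option autoImplicit false
-- sibling precedent (`KatoDescentTamePotSupersingularTameLowerFouquetRoadBCS.lean`): the directory name repeats the summit name
set_option linter.dupNamespace false

noncomputable section

open scoped Classical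

open WeierstrassCurve Literature.NumberTheory.EllipticCurves
  Literature.NumberTheory.EllipticCurves.ModularForms
  Literature.NumberTheory.EllipticCurves.Rank1Residual
  Literature.NumberTheory.EllipticCurves.Rank1Residual.Typed
  Literature.NumberTheory.EllipticCurves.Rank1Residual.X11RankOneCertificates
  Summit.BirchSwinnertonDyer.BirchSwinnertonDyer.Rank1Residual.IntModel
  Summit.BirchSwinnertonDyer.BirchSwinnertonDyer.Rank1Residual.X11RankOne
  Summit.BirchSwinnertonDyer.Rank1Residual.X11b
  Summit.BirchSwinnertonDyer.Rank1Residual.Supersingular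
  Summit.BirchSwinnertonDyer.Rank1Residual.Supersingular.RootCensusNewton
  Summit.BirchSwinnertonDyer.Rank1Residual.Supersingular.LocalOddTorsion
  Summit.BirchSwinnertonDyer.BirchSwinnertonDyer.Theorems

namespace Summit.BirchSwinnertonDyer.BirchSwinnertonDyer.Theorems.KTSeedRowC

/-- `40200g1` = `[0, -1, 0, -288062708, -1881726588588]` (Cremona) has `Δ ≠ 0`. [cite: Cremona1997, Table 1 (label 40200g1)] -/
theorem isElliptic_v40200g1 : (⟨0, -1, 0, -288062708, -1881726588588⟩ : WeierstrassCurve ℚ).IsElliptic :=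
  isElliptic_of_discOf_ne_zero 0 (-1) 0 (-288062708) (-1881726588588) (by decide +kernel)

-- `decide` evaluates `discOf`/`c4Of`/`c6Of` and the Kraus tests on the literal coefficients
set_option maxRecDepth 100000 in
/-- `40200g1` = `[0, -1, 0, -288062708, -1881726588588]` (Cremona) is globally minimal — Kraus' criterion, factored form `|Δ| = 2^8 · 3^18 · 5^10 · 67`, in the kernel.
[cite: Kraus1989, Prop. 1 and Prop. 2] [cite: SilvermanAEC2009, VII.1 Remark 1.1] [cite: Cremona1997, Table 1 (label 40200g1)] -/
theorem isGloballyMinimal_v40200g1 : (⟨0, -1, 0, -288062708, -1881726588588⟩ : WeierstrassCurve ℚ).IsGloballyMinimal :=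
  isGloballyMinimal_of_krausCriterion₃_factored 0 (-1) 0 (-288062708) (-1881726588588) [(2, 8), (3, 18), (5, 10), (67, 1)] (by decide +kernel)
    (by intro qe hqe; fin_cases hqe <;> norm_num) (by decide +kernel)

/-- `1608a1` = `[0, -1, 0, -25, 61]` (Cremona) has `Δ ≠ 0`. [cite: Cremona1997, Table 1 (label 1608a1)] -/
theorem isElliptic_c1608a1 : (⟨0, -1, 0, -25, 61⟩ : WeierstrassCurve ℚ).IsElliptic :=
  isElliptic_of_discOf_ne_zero 0 (-1) 0 (-25) 61 (by decide +kernel)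

-- `decide` evaluates `discOf`/`c4Of`/`c6Of` and the Kraus tests on the literal coefficients
set_option maxRecDepth 100000 in
/-- `1608a1` = `[0, -1, 0, -25, 61]` (Cremona) is globally minimal — Kraus' criterion, factored form `|Δ| = 2^8 · 3^2 · 67`, in the kernel.
[cite: Kraus1989, Prop. 1 and Prop. 2] [cite: SilvermanAEC2009, VII.1 Remark 1.1] [cite: Cremona1997, Table 1 (label 1608a1)] -/
theorem isGloballyMinimal_c1608a1 : (⟨0, -1, 0, -25, 61⟩ : WeierstrassCurve ℚ).IsGloballyMinimal :=
  isGloballyMinimal_of_krausCriterion₃_factored 0 (-1) 0 (-25) 61 [(2, 8), (3, 2), (67, 1)] (by decide +kernel)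
    (by intro qe hqe; fin_cases hqe <;> norm_num) (by decide +kernel)

-- `decide` evaluates the schema point counts, the supports and the two root censuses on the literal coefficients
set_option maxRecDepth 100000 in
/-- **L₀ = `ord_5 #Ш_an ≤ ord_5 #Ш` for `40200g1`** (Cremona's minimal model `[0, -1, 0, -288062708, -1881726588588]`, `N = 40200 = 25·1608`; additive
potentially supersingular TAME (t′) at `5`, Kodaira `II*` with `v₅(c₄) = 4` (cell `L_{II*,5}`); `r_an = 0`, `#Ш_an = 25` (`ord₅ = 2`),
`∏ c_ℓ = 4`, `#E(ℚ)_tors = 1`; census verdict `SEED-strict` tier B)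
**by the SeedRowC road from the partner `1608a1`** `[0, -1, 0, -25, 61]` (rank `2`, good ORDINARY at `5`: `#G̃(𝔽₅) = 10`, `a₅ = -4`
— `a₅² ≡ 1 (mod 5)`: the Fouquet Thm 2.10 input is the Colmez–Wang PREPRINT on this row, flag `@Fouquet-2.10-via-ColmezWang-PRE`; `ρ̄_{G,5}` onto).
IN THE KERNEL: `Δ ≠ 0` and global minimality of both equations (Kraus, factored form: `|Δ_W| = 2^8 · 3^18 · 5^10 · 67`,
`|Δ_G| = 2^8 · 3^2 · 67`); `ρ̄_{W,5}` and `ρ̄_{G,5}` onto by Serre Prop. 19 witnesses at `ℓ = 13, 7, 7`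
(`#W̃ = 8, 12, 12`; `#G̃ = 18, 12, 12`); `GoodOrd G 5`; strict level compatibility (every prime of `Δ_G`
divides `Δ_W` or is `5`); Ass. 3.4 in Tate form for `W` (no multiplicative prime q with 5 ∣ v_q(Δ_min): vacuous); Ass. 2.9 (2) EXACTLY (`ΨSq_5`
rootless in `ℚ_5`) by the two Hensel root censuses `check₄ 5 prePsi5Z 2 [] ∧ check₄ 5 prePsi5Z.reverse 2 []`.
BINDERS: named facts (A′) `hA`, BCS Thm 1.1.2 (b) `hBCS`, modularity `hmodN`, GZK `hGZK`, Kraus–Oesterlé Prop. 4 `hKO`; the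
instances (proved below as `isElliptic_…` / `isGloballyMinimal_…`); Cremona's `r_an = 0` (`hr`); the FINITE K–O trace list `hlist`
(kit j265271, engines A = PARI `scan.gp` / B = `engineB.py` of kt-pdesc g2 VERBATIM: K–O modulus `M = 40200`, `S = []`, `μ(M) = 97920`, bound `ℓ ≤ 16319`: 1893 primes, engine A PASS = engine B PASS (PASS 16319 1893)). Per-row instance of `SeedRowC`; the
class-wide statement and the items stay OPEN; nothing booked; BSD is not proved for this curve by this file.
[cite: Fouquet2025EquivariantTNC, Thm 4.1 (1)⇒(2) (pp. 24–25), Ass. 2.9 (p. 15), Ass. 3.4 (pp. 22–23)] [cite: BurungaleCastellaSkinner2025, Thm 1.1.2 (b)]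
[cite: KrausOesterle1992, Prop. 4] [cite: Serre1972, §2.8 Prop. 19] [cite: Cremona1997, Table 1 (labels 40200g1, 1608a1)] [cite: Miller2011LMS, Def. 1.1] -/
theorem tameLower_bcs_v40200g1
    (hA : Fouquet2025.padicValRat_bsd_rank_zero_of_congruence_of_seedMainIdentity)
    (hBCS : burungale_castella_skinner_charIdeal_eq_padicLFunction_integral) (hmodN : exists_isNewformOf)
    (hGZK : rank_eq_analyticRank_of_analyticRank_le_one) (hKO : KrausOesterle1992.prop4_torsionIso_of_congruences)
    (W G : WeierstrassCurve ℚ) [W.IsElliptic] [W.IsGloballyMinimal] [G.IsElliptic] [G.IsGloballyMinimal]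
    (hW : W = ⟨0, -1, 0, -288062708, -1881726588588⟩) (hG : G = ⟨0, -1, 0, -25, 61⟩) (hr : W.analyticRank = 0)
    (hlist : ∀ (ℓ : ℕ) [Fact ℓ.Prime],
      6 * ℓ < KrausOesterle1992.gammaZeroIndex (KrausOesterle1992.modulus W G) →
      (padicValNat ℓ (W.conductorNorm ℤ * G.conductorNorm ℤ) = 0 →
          (5 : ℤ) ∣ W.frobeniusTrace ℓ - G.frobeniusTrace ℓ) ∧
        (padicValNat ℓ (W.conductorNorm ℤ * G.conductorNorm ℤ) = 1 →
          (5 : ℤ) ∣ W.frobeniusTrace ℓ * G.frobeniusTrace ℓ - (ℓ + 1))) :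
    MissingLowerBoundAt W 5 := by
  subst hW hG
  have hminW : (⟨0, -1, 0, -288062708, -1881726588588⟩ : WeierstrassCurve ℚ).IsGloballyMinimal := inferInstance
  have hminG : (⟨0, -1, 0, -25, 61⟩ : WeierstrassCurve ℚ).IsGloballyMinimal := inferInstance
  have hIW : integralModelInt (⟨0, -1, 0, -288062708, -1881726588588⟩ : WeierstrassCurve ℚ) = (⟨0, -1, 0, -288062708, -1881726588588⟩ : WeierstrassCurve ℤ) :=
    integralModelInt_eq_of_map_eq _ (map_mk_int 0 (-1) 0 (-288062708) (-1881726588588))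
  have hIG : integralModelInt (⟨0, -1, 0, -25, 61⟩ : WeierstrassCurve ℚ) = (⟨0, -1, 0, -25, 61⟩ : WeierstrassCurve ℤ) :=
    integralModelInt_eq_of_map_eq _ (map_mk_int 0 (-1) 0 (-25) 61)
  have hsurjW : Surj (⟨0, -1, 0, -288062708, -1881726588588⟩ : WeierstrassCurve ℚ) 5 :=
    @surj_of_ainvs_of_serreWitnesses 0 (-1) 0 (-288062708) (-1881726588588) 5 ⟨by norm_num⟩ (by norm_num) hminW
      13 7 7 (by norm_num) (by norm_num) (by norm_num) (by decide) (by decide) (by decide)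
      (by decide) (by decide) (by decide) (by decide +kernel) (by decide +kernel) (by decide +kernel)
      (n₁ := 8) (n₂ := 12) (n₃ := 12) (by decide +kernel) (by decide +kernel) (by decide +kernel)
      (2 : ZMod 5) (3 : ZMod 5) (by decide +kernel) (by decide +kernel) (by decide +kernel)
  have hsurjG : Surj (⟨0, -1, 0, -25, 61⟩ : WeierstrassCurve ℚ) 5 :=
    @surj_of_ainvs_of_serreWitnesses 0 (-1) 0 (-25) 61 5 ⟨by norm_num⟩ (by norm_num) hminG
      13 7 7 (by norm_num) (by norm_num) (by norm_num) (by decide) (by decide) (by decide)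
      (by decide) (by decide) (by decide) (by decide +kernel) (by decide +kernel) (by decide +kernel)
      (n₁ := 18) (n₂ := 12) (n₃ := 12) (by decide +kernel) (by decide +kernel) (by decide +kernel)
      (2 : ZMod 5) (3 : ZMod 5) (by decide +kernel) (by decide +kernel) (by decide +kernel)
  have hordG : GoodOrd (⟨0, -1, 0, -25, 61⟩ : WeierstrassCurve ℚ) 5 :=
    @KTSeedRec.goodOrd_of_countPoints 0 (-1) 0 (-25) 61 5 ⟨by norm_num⟩ (by norm_num) hminG (by decide +kernel) 10
      (by decide +kernel) (by decide)
  have hlev : FouquetLevelCompatibleAt 5 (⟨0, -1, 0, -288062708, -1881726588588⟩ : WeierstrassCurve ℚ) (⟨0, -1, 0, -25, 61⟩ : WeierstrassCurve ℚ) :=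
    @KTSeedRec.fouquetLevelCompatibleAt_of_factorList 5 ⟨by norm_num⟩ _ _ _ _ _ _ _ _ hIW hIG [(2, 8), (3, 2), (67, 1)]
      (by intro qe hqe; fin_cases hqe <;> norm_num) (by rw [intCurve_Δ]; decide +kernel)
      (by simp only [intCurve_Δ]; decide +kernel)
  have h34 : Fouquet2025.Assumption34TateAt 5 (⟨0, -1, 0, -288062708, -1881726588588⟩ : WeierstrassCurve ℚ) :=
    KTSeedRec.assumption34TateAt_of_factorList 5 hIW [(2, 8), (3, 18), (5, 10), (67, 1)]
      (by intro qe hqe; fin_cases hqe <;> norm_num) (by rw [intCurve_Δ]; decide +kernel)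
      (by simp only [intCurve_Δ, intCurve_c₄]; decide +kernel)
  have hgen := KTSeedRec.fouquetGenericAt_five_of_rootCensus 0 (-1) 0 (-288062708) (-1881726588588) 2 2 (by decide +kernel)
    (by decide +kernel)
  haveI : Fact (Nat.Prime 5) := ⟨by norm_num⟩
  exact missingLowerBoundAt_rankZero_of_bcsSeed_of_prop4 _ _ 5 hA hBCS hmodN hGZK hKO (by norm_num) hr hsurjW hgen h34
    hordG hsurjG hlev hlist

/-- `50575q1` = `[1, 1, 1, -1087513, -714284594]` (Cremona) has `Δ ≠ 0`. [cite: Cremona1997, Table 1 (label 50575q1)] -/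
theorem isElliptic_v50575q1 : (⟨1, 1, 1, -1087513, -714284594⟩ : WeierstrassCurve ℚ).IsElliptic :=
  isElliptic_of_discOf_ne_zero 1 1 1 (-1087513) (-714284594) (by decide +kernel)

-- `decide` evaluates `discOf`/`c4Of`/`c6Of` and the Kraus tests on the literal coefficients
set_option maxRecDepth 100000 in
/-- `50575q1` = `[1, 1, 1, -1087513, -714284594]` (Cremona) is globally minimal — Kraus' criterion, factored form `|Δ| = 5^10 · 7 · 17^10`, in the kernel.
[cite: Kraus1989, Prop. 1 and Prop. 2] [cite: SilvermanAEC2009, VII.1 Remark 1.1] [cite: Cremona1997, Table 1 (label 50575q1)] -/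
theorem isGloballyMinimal_v50575q1 : (⟨1, 1, 1, -1087513, -714284594⟩ : WeierstrassCurve ℚ).IsGloballyMinimal :=
  isGloballyMinimal_of_krausCriterion₃_factored 1 1 1 (-1087513) (-714284594) [(5, 10), (7, 1), (17, 10)] (by decide +kernel)
    (by intro qe hqe; fin_cases hqe <;> norm_num) (by decide +kernel)

/-- `2023b1` = `[1, -1, 1, -12, 0]` (Cremona) has `Δ ≠ 0`. [cite: Cremona1997, Table 1 (label 2023b1)] -/
theorem isElliptic_c2023b1 : (⟨1, -1, 1, -12, 0⟩ : WeierstrassCurve ℚ).IsElliptic :=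
  isElliptic_of_discOf_ne_zero 1 (-1) 1 (-12) 0 (by decide +kernel)

-- `decide` evaluates `discOf`/`c4Of`/`c6Of` and the Kraus tests on the literal coefficients
set_option maxRecDepth 100000 in
/-- `2023b1` = `[1, -1, 1, -12, 0]` (Cremona) is globally minimal — Kraus' criterion, factored form `|Δ| = 7^3 · 17^2`, in the kernel.
[cite: Kraus1989, Prop. 1 and Prop. 2] [cite: SilvermanAEC2009, VII.1 Remark 1.1] [cite: Cremona1997, Table 1 (label 2023b1)] -/
theorem isGloballyMinimal_c2023b1 : (⟨1, -1, 1, -12, 0⟩ : WeierstrassCurve ℚ).IsGloballyMinimal :=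
  isGloballyMinimal_of_krausCriterion₃_factored 1 (-1) 1 (-12) 0 [(7, 3), (17, 2)] (by decide +kernel)
    (by intro qe hqe; fin_cases hqe <;> norm_num) (by decide +kernel)

-- `decide` evaluates the schema point counts, the supports and the two root censuses on the literal coefficients
set_option maxRecDepth 100000 in
/-- **L₀ = `ord_5 #Ш_an ≤ ord_5 #Ш` for `50575q1`** (Cremona's minimal model `[1, 1, 1, -1087513, -714284594]`, `N = 50575 = 25·2023`; additive
potentially supersingular TAME (t′) at `5`, Kodaira `II*` with `v₅(c₄) = 4` (cell `L_{II*,5}`); `r_an = 0`, `#Ш_an = 25` (`ord₅ = 2`),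
`∏ c_ℓ = 1`, `#E(ℚ)_tors = 1`; census verdict `SEED-strict` tier B)
**by the SeedRowC road from the partner `2023b1`** `[1, -1, 1, -12, 0]` (rank `2`, good ORDINARY at `5`: `#G̃(𝔽₅) = 10`, `a₅ = -4`
— `a₅² ≡ 1 (mod 5)`: the Fouquet Thm 2.10 input is the Colmez–Wang PREPRINT on this row, flag `@Fouquet-2.10-via-ColmezWang-PRE`; `ρ̄_{G,5}` onto).
IN THE KERNEL: `Δ ≠ 0` and global minimality of both equations (Kraus, factored form: `|Δ_W| = 5^10 · 7 · 17^10`,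
`|Δ_G| = 7^3 · 17^2`); `ρ̄_{W,5}` and `ρ̄_{G,5}` onto by Serre Prop. 19 witnesses at `ℓ = 23, 3, 3`
(`#W̃ = 23, 2, 2`; `#G̃ = 28, 7, 7`); `GoodOrd G 5`; strict level compatibility (every prime of `Δ_G`
divides `Δ_W` or is `5`); Ass. 3.4 in Tate form for `W` (q = 17: 5 ∣ v_q(Δ) = 10 but q ≢ 1 (mod 5)); Ass. 2.9 (2) EXACTLY (`ΨSq_5`
rootless in `ℚ_5`) by the two Hensel root censuses `check₄ 5 prePsi5Z 2 [] ∧ check₄ 5 prePsi5Z.reverse 1 []`.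
BINDERS: named facts (A′) `hA`, BCS Thm 1.1.2 (b) `hBCS`, modularity `hmodN`, GZK `hGZK`, Kraus–Oesterlé Prop. 4 `hKO`; the
instances (proved below as `isElliptic_…` / `isGloballyMinimal_…`); Cremona's `r_an = 0` (`hr`); the FINITE K–O trace list `hlist`
(kit j265273, engines A = PARI `scan.gp` / B = `engineB.py` of kt-pdesc g2 VERBATIM: K–O modulus `M = 50575`, `S = []`, `μ(M) = 73440`, bound `ℓ ≤ 12239`: 1462 primes, engine A PASS = engine B PASS (PASS 12239 1462)). Per-row instance of `SeedRowC`; the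
class-wide statement and the items stay OPEN; nothing booked; BSD is not proved for this curve by this file.
[cite: Fouquet2025EquivariantTNC, Thm 4.1 (1)⇒(2) (pp. 24–25), Ass. 2.9 (p. 15), Ass. 3.4 (pp. 22–23)] [cite: BurungaleCastellaSkinner2025, Thm 1.1.2 (b)]
[cite: KrausOesterle1992, Prop. 4] [cite: Serre1972, §2.8 Prop. 19] [cite: Cremona1997, Table 1 (labels 50575q1, 2023b1)] [cite: Miller2011LMS, Def. 1.1] -/
theorem tameLower_bcs_v50575q1
    (hA : Fouquet2025.padicValRat_bsd_rank_zero_of_congruence_of_seedMainIdentity)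
    (hBCS : burungale_castella_skinner_charIdeal_eq_padicLFunction_integral) (hmodN : exists_isNewformOf)
    (hGZK : rank_eq_analyticRank_of_analyticRank_le_one) (hKO : KrausOesterle1992.prop4_torsionIso_of_congruences)
    (W G : WeierstrassCurve ℚ) [W.IsElliptic] [W.IsGloballyMinimal] [G.IsElliptic] [G.IsGloballyMinimal]
    (hW : W = ⟨1, 1, 1, -1087513, -714284594⟩) (hG : G = ⟨1, -1, 1, -12, 0⟩) (hr : W.analyticRank = 0)
    (hlist : ∀ (ℓ : ℕ) [Fact ℓ.Prime],
      6 * ℓ < KrausOesterle1992.gammaZeroIndex (KrausOesterle1992.modulus W G) →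
      (padicValNat ℓ (W.conductorNorm ℤ * G.conductorNorm ℤ) = 0 →
          (5 : ℤ) ∣ W.frobeniusTrace ℓ - G.frobeniusTrace ℓ) ∧
        (padicValNat ℓ (W.conductorNorm ℤ * G.conductorNorm ℤ) = 1 →
          (5 : ℤ) ∣ W.frobeniusTrace ℓ * G.frobeniusTrace ℓ - (ℓ + 1))) :
    MissingLowerBoundAt W 5 := by
  subst hW hG
  have hminW : (⟨1, 1, 1, -1087513, -714284594⟩ : WeierstrassCurve ℚ).IsGloballyMinimal := inferInstance
  have hminG : (⟨1, -1, 1, -12, 0⟩ : WeierstrassCurve ℚ).IsGloballyMinimal := inferInstance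
  have hIW : integralModelInt (⟨1, 1, 1, -1087513, -714284594⟩ : WeierstrassCurve ℚ) = (⟨1, 1, 1, -1087513, -714284594⟩ : WeierstrassCurve ℤ) :=
    integralModelInt_eq_of_map_eq _ (map_mk_int 1 1 1 (-1087513) (-714284594))
  have hIG : integralModelInt (⟨1, -1, 1, -12, 0⟩ : WeierstrassCurve ℚ) = (⟨1, -1, 1, -12, 0⟩ : WeierstrassCurve ℤ) :=
    integralModelInt_eq_of_map_eq _ (map_mk_int 1 (-1) 1 (-12) 0)
  have hsurjW : Surj (⟨1, 1, 1, -1087513, -714284594⟩ : WeierstrassCurve ℚ) 5 :=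
    @surj_of_ainvs_of_serreWitnesses 1 1 1 (-1087513) (-714284594) 5 ⟨by norm_num⟩ (by norm_num) hminW
      23 3 3 (by norm_num) (by norm_num) (by norm_num) (by decide) (by decide) (by decide)
      (by decide) (by decide) (by decide) (by decide +kernel) (by decide +kernel) (by decide +kernel)
      (n₁ := 23) (n₂ := 2) (n₃ := 2) (by decide +kernel) (by decide +kernel) (by decide +kernel)
      (2 : ZMod 5) (3 : ZMod 5) (by decide +kernel) (by decide +kernel) (by decide +kernel)
  have hsurjG : Surj (⟨1, -1, 1, -12, 0⟩ : WeierstrassCurve ℚ) 5 :=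
    @surj_of_ainvs_of_serreWitnesses 1 (-1) 1 (-12) 0 5 ⟨by norm_num⟩ (by norm_num) hminG
      23 3 3 (by norm_num) (by norm_num) (by norm_num) (by decide) (by decide) (by decide)
      (by decide) (by decide) (by decide) (by decide +kernel) (by decide +kernel) (by decide +kernel)
      (n₁ := 28) (n₂ := 7) (n₃ := 7) (by decide +kernel) (by decide +kernel) (by decide +kernel)
      (2 : ZMod 5) (3 : ZMod 5) (by decide +kernel) (by decide +kernel) (by decide +kernel)
  have hordG : GoodOrd (⟨1, -1, 1, -12, 0⟩ : WeierstrassCurve ℚ) 5 :=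
    @KTSeedRec.goodOrd_of_countPoints 1 (-1) 1 (-12) 0 5 ⟨by norm_num⟩ (by norm_num) hminG (by decide +kernel) 10
      (by decide +kernel) (by decide)
  have hlev : FouquetLevelCompatibleAt 5 (⟨1, 1, 1, -1087513, -714284594⟩ : WeierstrassCurve ℚ) (⟨1, -1, 1, -12, 0⟩ : WeierstrassCurve ℚ) :=
    @KTSeedRec.fouquetLevelCompatibleAt_of_factorList 5 ⟨by norm_num⟩ _ _ _ _ _ _ _ _ hIW hIG [(7, 3), (17, 2)]
      (by intro qe hqe; fin_cases hqe <;> norm_num) (by rw [intCurve_Δ]; decide +kernel)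
      (by simp only [intCurve_Δ]; decide +kernel)
  have h34 : Fouquet2025.Assumption34TateAt 5 (⟨1, 1, 1, -1087513, -714284594⟩ : WeierstrassCurve ℚ) :=
    KTSeedRec.assumption34TateAt_of_factorList 5 hIW [(5, 10), (7, 1), (17, 10)]
      (by intro qe hqe; fin_cases hqe <;> norm_num) (by rw [intCurve_Δ]; decide +kernel)
      (by simp only [intCurve_Δ, intCurve_c₄]; decide +kernel)
  have hgen := KTSeedRec.fouquetGenericAt_five_of_rootCensus 1 1 1 (-1087513) (-714284594) 2 1 (by decide +kernel)
    (by decide +kernel)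
  haveI : Fact (Nat.Prime 5) := ⟨by norm_num⟩
  exact missingLowerBoundAt_rankZero_of_bcsSeed_of_prop4 _ _ 5 hA hBCS hmodN hGZK hKO (by norm_num) hr hsurjW hgen h34
    hordG hsurjG hlev hlist

/-- `63700d1` = `[0, -1, 0, -1357708, -665936088]` (Cremona) has `Δ ≠ 0`. [cite: Cremona1997, Table 1 (label 63700d1)] -/
theorem isElliptic_v63700d1 : (⟨0, -1, 0, -1357708, -665936088⟩ : WeierstrassCurve ℚ).IsElliptic :=
  isElliptic_of_discOf_ne_zero 0 (-1) 0 (-1357708) (-665936088) (by decide +kernel)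

-- `decide` evaluates `discOf`/`c4Of`/`c6Of` and the Kraus tests on the literal coefficients
set_option maxRecDepth 100000 in
/-- `63700d1` = `[0, -1, 0, -1357708, -665936088]` (Cremona) is globally minimal — Kraus' criterion, factored form `|Δ| = 2^8 · 5^10 · 7^8 · 13^3`, in the kernel.
[cite: Kraus1989, Prop. 1 and Prop. 2] [cite: SilvermanAEC2009, VII.1 Remark 1.1] [cite: Cremona1997, Table 1 (label 63700d1)] -/
theorem isGloballyMinimal_v63700d1 : (⟨0, -1, 0, -1357708, -665936088⟩ : WeierstrassCurve ℚ).IsGloballyMinimal :=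
  isGloballyMinimal_of_krausCriterion₃_factored 0 (-1) 0 (-1357708) (-665936088) [(2, 8), (5, 10), (7, 8), (13, 3)] (by decide +kernel)
    (by intro qe hqe; fin_cases hqe <;> norm_num) (by decide +kernel)

/-- `2548a1` = `[0, 0, 0, -49, 49]` (Cremona) has `Δ ≠ 0`. [cite: Cremona1997, Table 1 (label 2548a1)] -/
theorem isElliptic_c2548a1 : (⟨0, 0, 0, -49, 49⟩ : WeierstrassCurve ℚ).IsElliptic :=
  isElliptic_of_discOf_ne_zero 0 0 0 (-49) 49 (by decide +kernel)

-- `decide` evaluates `discOf`/`c4Of`/`c6Of` and the Kraus tests on the literal coefficients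
set_option maxRecDepth 100000 in
/-- `2548a1` = `[0, 0, 0, -49, 49]` (Cremona) is globally minimal — Kraus' criterion, factored form `|Δ| = 2^4 · 7^4 · 13^2`, in the kernel.
[cite: Kraus1989, Prop. 1 and Prop. 2] [cite: SilvermanAEC2009, VII.1 Remark 1.1] [cite: Cremona1997, Table 1 (label 2548a1)] -/
theorem isGloballyMinimal_c2548a1 : (⟨0, 0, 0, -49, 49⟩ : WeierstrassCurve ℚ).IsGloballyMinimal :=
  isGloballyMinimal_of_krausCriterion₃_factored 0 0 0 (-49) 49 [(2, 4), (7, 4), (13, 2)] (by decide +kernel)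
    (by intro qe hqe; fin_cases hqe <;> norm_num) (by decide +kernel)

-- `decide` evaluates the schema point counts, the supports and the two root censuses on the literal coefficients
set_option maxRecDepth 100000 in
/-- **L₀ = `ord_5 #Ш_an ≤ ord_5 #Ш` for `63700d1`** (Cremona's minimal model `[0, -1, 0, -1357708, -665936088]`, `N = 63700 = 25·2548`; additive
potentially supersingular TAME (t′) at `5`, Kodaira `II*` with `v₅(c₄) = 4` (cell `L_{II*,5}`); `r_an = 0`, `#Ш_an = 25` (`ord₅ = 2`),
`∏ c_ℓ = 1`, `#E(ℚ)_tors = 1`; census verdict `SEED-strict` tier A)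
**by the SeedRowC road from the partner `2548a1`** `[0, 0, 0, -49, 49]` (rank `2`, good ORDINARY at `5`: `#G̃(𝔽₅) = 9`, `a₅ = -3`
— `a₅² ≢ 1 (mod 5)`: preprint-free chain, Nakamura 2023; `ρ̄_{G,5}` onto).
IN THE KERNEL: `Δ ≠ 0` and global minimality of both equations (Kraus, factored form: `|Δ_W| = 2^8 · 5^10 · 7^8 · 13^3`,
`|Δ_G| = 2^4 · 7^4 · 13^2`); `ρ̄_{W,5}` and `ρ̄_{G,5}` onto by Serre Prop. 19 witnesses at `ℓ = 23, 3, 3`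
(`#W̃ = 30, 2, 2`; `#G̃ = 25, 7, 7`); `GoodOrd G 5`; strict level compatibility (every prime of `Δ_G`
divides `Δ_W` or is `5`); Ass. 3.4 in Tate form for `W` (no multiplicative prime q with 5 ∣ v_q(Δ_min): vacuous); Ass. 2.9 (2) EXACTLY (`ΨSq_5`
rootless in `ℚ_5`) by the two Hensel root censuses `check₄ 5 prePsi5Z 2 [] ∧ check₄ 5 prePsi5Z.reverse 2 []`.
BINDERS: named facts (A′) `hA`, BCS Thm 1.1.2 (b) `hBCS`, modularity `hmodN`, GZK `hGZK`, Kraus–Oesterlé Prop. 4 `hKO`; the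
instances (proved below as `isElliptic_…` / `isGloballyMinimal_…`); Cremona's `r_an = 0` (`hr`); the FINITE K–O trace list `hlist`
(kit j265274, engines A = PARI `scan.gp` / B = `engineB.py` of kt-pdesc g2 VERBATIM: K–O modulus `M = 63700`, `S = []`, `μ(M) = 141120`, bound `ℓ ≤ 23519`: 2614 primes, engine A PASS = engine B PASS (PASS 23519 2614)). Per-row instance of `SeedRowC`; the
class-wide statement and the items stay OPEN; nothing booked; BSD is not proved for this curve by this file.
[cite: Fouquet2025EquivariantTNC, Thm 4.1 (1)⇒(2) (pp. 24–25), Ass. 2.9 (p. 15), Ass. 3.4 (pp. 22–23)] [cite: BurungaleCastellaSkinner2025, Thm 1.1.2 (b)]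
[cite: KrausOesterle1992, Prop. 4] [cite: Serre1972, §2.8 Prop. 19] [cite: Cremona1997, Table 1 (labels 63700d1, 2548a1)] [cite: Miller2011LMS, Def. 1.1] -/
theorem tameLower_bcs_v63700d1
    (hA : Fouquet2025.padicValRat_bsd_rank_zero_of_congruence_of_seedMainIdentity)
    (hBCS : burungale_castella_skinner_charIdeal_eq_padicLFunction_integral) (hmodN : exists_isNewformOf)
    (hGZK : rank_eq_analyticRank_of_analyticRank_le_one) (hKO : KrausOesterle1992.prop4_torsionIso_of_congruences)
    (W G : WeierstrassCurve ℚ) [W.IsElliptic] [W.IsGloballyMinimal] [G.IsElliptic] [G.IsGloballyMinimal]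
    (hW : W = ⟨0, -1, 0, -1357708, -665936088⟩) (hG : G = ⟨0, 0, 0, -49, 49⟩) (hr : W.analyticRank = 0)
    (hlist : ∀ (ℓ : ℕ) [Fact ℓ.Prime],
      6 * ℓ < KrausOesterle1992.gammaZeroIndex (KrausOesterle1992.modulus W G) →
      (padicValNat ℓ (W.conductorNorm ℤ * G.conductorNorm ℤ) = 0 →
          (5 : ℤ) ∣ W.frobeniusTrace ℓ - G.frobeniusTrace ℓ) ∧
        (padicValNat ℓ (W.conductorNorm ℤ * G.conductorNorm ℤ) = 1 →
          (5 : ℤ) ∣ W.frobeniusTrace ℓ * G.frobeniusTrace ℓ - (ℓ + 1))) :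
    MissingLowerBoundAt W 5 := by
  subst hW hG
  have hminW : (⟨0, -1, 0, -1357708, -665936088⟩ : WeierstrassCurve ℚ).IsGloballyMinimal := inferInstance
  have hminG : (⟨0, 0, 0, -49, 49⟩ : WeierstrassCurve ℚ).IsGloballyMinimal := inferInstance
  have hIW : integralModelInt (⟨0, -1, 0, -1357708, -665936088⟩ : WeierstrassCurve ℚ) = (⟨0, -1, 0, -1357708, -665936088⟩ : WeierstrassCurve ℤ) :=
    integralModelInt_eq_of_map_eq _ (map_mk_int 0 (-1) 0 (-1357708) (-665936088))
  have hIG : integralModelInt (⟨0, 0, 0, -49, 49⟩ : WeierstrassCurve ℚ) = (⟨0, 0, 0, -49, 49⟩ : WeierstrassCurve ℤ) :=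
    integralModelInt_eq_of_map_eq _ (map_mk_int 0 0 0 (-49) 49)
  have hsurjW : Surj (⟨0, -1, 0, -1357708, -665936088⟩ : WeierstrassCurve ℚ) 5 :=
    @surj_of_ainvs_of_serreWitnesses 0 (-1) 0 (-1357708) (-665936088) 5 ⟨by norm_num⟩ (by norm_num) hminW
      23 3 3 (by norm_num) (by norm_num) (by norm_num) (by decide) (by decide) (by decide)
      (by decide) (by decide) (by decide) (by decide +kernel) (by decide +kernel) (by decide +kernel)
      (n₁ := 30) (n₂ := 2) (n₃ := 2) (by decide +kernel) (by decide +kernel) (by decide +kernel)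
      (2 : ZMod 5) (3 : ZMod 5) (by decide +kernel) (by decide +kernel) (by decide +kernel)
  have hsurjG : Surj (⟨0, 0, 0, -49, 49⟩ : WeierstrassCurve ℚ) 5 :=
    @surj_of_ainvs_of_serreWitnesses 0 0 0 (-49) 49 5 ⟨by norm_num⟩ (by norm_num) hminG
      23 3 3 (by norm_num) (by norm_num) (by norm_num) (by decide) (by decide) (by decide)
      (by decide) (by decide) (by decide) (by decide +kernel) (by decide +kernel) (by decide +kernel)
      (n₁ := 25) (n₂ := 7) (n₃ := 7) (by decide +kernel) (by decide +kernel) (by decide +kernel)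
      (2 : ZMod 5) (3 : ZMod 5) (by decide +kernel) (by decide +kernel) (by decide +kernel)
  have hordG : GoodOrd (⟨0, 0, 0, -49, 49⟩ : WeierstrassCurve ℚ) 5 :=
    @KTSeedRec.goodOrd_of_countPoints 0 0 0 (-49) 49 5 ⟨by norm_num⟩ (by norm_num) hminG (by decide +kernel) 9
      (by decide +kernel) (by decide)
  have hlev : FouquetLevelCompatibleAt 5 (⟨0, -1, 0, -1357708, -665936088⟩ : WeierstrassCurve ℚ) (⟨0, 0, 0, -49, 49⟩ : WeierstrassCurve ℚ) :=
    @KTSeedRec.fouquetLevelCompatibleAt_of_factorList 5 ⟨by norm_num⟩ _ _ _ _ _ _ _ _ hIW hIG [(2, 4), (7, 4), (13, 2)]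
      (by intro qe hqe; fin_cases hqe <;> norm_num) (by rw [intCurve_Δ]; decide +kernel)
      (by simp only [intCurve_Δ]; decide +kernel)
  have h34 : Fouquet2025.Assumption34TateAt 5 (⟨0, -1, 0, -1357708, -665936088⟩ : WeierstrassCurve ℚ) :=
    KTSeedRec.assumption34TateAt_of_factorList 5 hIW [(2, 8), (5, 10), (7, 8), (13, 3)]
      (by intro qe hqe; fin_cases hqe <;> norm_num) (by rw [intCurve_Δ]; decide +kernel)
      (by simp only [intCurve_Δ, intCurve_c₄]; decide +kernel)
  have hgen := KTSeedRec.fouquetGenericAt_five_of_rootCensus 0 (-1) 0 (-1357708) (-665936088) 2 2 (by decide +kernel)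
    (by decide +kernel)
  haveI : Fact (Nat.Prime 5) := ⟨by norm_num⟩
  exact missingLowerBoundAt_rankZero_of_bcsSeed_of_prop4 _ _ 5 hA hBCS hmodN hGZK hKO (by norm_num) hr hsurjW hgen h34
    hordG hsurjG hlev hlist

end Summit.BirchSwinnertonDyer.BirchSwinnertonDyer.Theorems.KTSeedRowC

end
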